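import Literature.NumberTheory.EllipticCurves.RootNumberTableThreeRowsProofs
import HarnessLib

/-!
# Table II is complete on elliptic curves over `ℚ`: `W₃ = ±1` (Rizzo 2003, §1.2 "Admissible triplets") — proofs

Sibling PROOF file of `Literature.NumberTheory.EllipticCurves.RootNumberTableThree` (the transcription
`Rizzo.tableII` of O. G. Rizzo, *Average root numbers for a nonconstant family of elliptic curves*,
Compositio Math. 136 (2003) 1–23 [Rizzo2003], Table II (p. 4), and the reading
`WeierstrassCurve.rootNumberThree` of its `W₃` column on the invariants `c₄, c₆, Δ` of a Weierstrass
equation over `ℚ`; that file is UNTOUCHED — nothing here is a definition or a named fact).  Main result: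

* `WeierstrassCurve.rootNumberThree_eq_one_or_eq_neg_one`: for every `W : WeierstrassCurve ℚ` with
  `[W.IsElliptic]` — ANY equation, integral or not, minimal or not — `W.rootNumberThree = 1 ∨
  W.rootNumberThree = -1`; the documented junk value `0` (off the 24 rows) is never taken
  (`rootNumberThree_sq_eq_one`, `rootNumberThree_ne_zero`, `Rizzo.ofInvariants_ne_junk`).

In print: [Rizzo2003, §1.2, Remark 4 (p. 6)] "If `p = 3`, we can read the list of admissible values in
Table III of [Papadopoulos 1993]: in particular, semi-admissibility still implies admissibility", and
§1.3 (p. 7): the tables are proved on "Papadopolous' list of possible triplets" (I. Papadopoulos,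
J. Number Theory 44 (1993) 119–152 [Papadopoulos1993], Table III at `p = 3`) — the rows of Table II
exhaust the reduced triples of elliptic curves over `ℚ₃`; the module docstring of `RootNumberTableThree`
records this as "part of the content of the named facts".  Downstream the theorem feeds, by name,
hypotheses "Table II signs are signs" (`∀ W [W.IsElliptic], W.rootNumberThree = 1 ∨
W.rootNumberThree = -1`).

## Proof (elementary: no Tate's algorithm, no minimality)

With `(α, β, γ) = (v₃(c₄), v₃(c₆), v₃(Δ))`, Mathlib's `WeierstrassCurve.c_relation` `1728Δ = c₄³ − c₆²`,
`v₃(1728) = 3` and the ultrametric (in)equality (`padicValRat.add_eq_min`,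
`padicValRat.min_le_padicValRat_add`) leave three cases (private `Rizzo.padicValRat_trichotomy_of_c_relation`):
(A) `3α < 2β` (or `c₆ = 0`) and `γ = 3α − 3`; (B) `2β < 3α` (or `c₄ = 0`) and `γ = 2β − 3`;
(C) `3α = 2β` and `γ ≥ 3α − 3`.  The shift `m = KellockDokchitser.shift γ v₃(c₆) v₃(c₄) =
min ⌊γ/12⌋ ⌊β/6⌋ ⌊α/4⌋` (Lean's integer division is a floor for positive divisors) subtracts
`m·(4, 6, 12)`, which preserves (A)/(B)/(C), and makes the reduced triple `(a, b, c)` non-negative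
with `a ≤ 3 ∨ b ≤ 5 ∨ c ≤ 11`; the row-support lemmas of `RootNumberTableThreeRowsProofs`
(`Rizzo.tableII_w_eq_one_or_eq_neg_one_of_trichotomy` / `…_of_c₄_eq_zero` / `…_of_c₆_eq_zero`) then
give the sign.

## What is NOT here

No identification of `W.rootNumberThree` with an intrinsically defined `w(E/ℚ₃)`; nothing about the
VALUES `±1` (the 923 952-curve validation recorded in `RootNumberTableThree` concerns them and is
untouched); neither named fact of that file is used or discharged; nothing at `p = 2`.
-/

namespace Literature.NumberTheory.EllipticCurves

namespace Rizzo

/-! ### The valuation trichotomy from `1728Δ = c₄³ − c₆²` -/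

/-- `v₃(1728) = 3` (`1728 = 2⁶·3³`). [folklore] -/
private theorem padicValRat_three_1728 : padicValRat 3 (1728 : ℚ) = 3 := by
  have h64 : padicValRat 3 (64 : ℚ) = 0 := by
    rw [show (64 : ℚ) = ((64 : ℕ) : ℚ) by norm_num, padicValRat.of_nat, Nat.cast_eq_zero]
    exact padicValNat.eq_zero_of_not_dvd (by norm_num)
  rw [show (1728 : ℚ) = (3 : ℚ) ^ 3 * 64 by norm_num, padicValRat.mul (by norm_num) (by norm_num),
    padicValRat.pow, show (3 : ℚ) = ((3 : ℕ) : ℚ) by norm_num, padicValRat.self (by norm_num), h64]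
  norm_num

/-- **The valuation trichotomy.**  For rational `c₄, c₆, Δ` with `1728·Δ = c₄³ − c₆²`, `Δ ≠ 0` and
`c₄ c₆ ≠ 0`, writing `α = v₃(c₄)`, `β = v₃(c₆)`, `γ = v₃(Δ)`: either `3α < 2β` and `γ = 3α − 3`, or
`2β < 3α` and `γ = 2β − 3`, or `3α = 2β` and `γ ≥ 3α − 3` (ultrametric inequality and `v₃(1728) = 3`)
— the elementary arithmetic behind the "possible triplets" of §1.2–1.3 (private: a standard computation,
not a printed statement). [folklore] -/
private theorem padicValRat_trichotomy_of_c_relation {c₄ c₆ Δ : ℚ} (hrel : 1728 * Δ = c₄ ^ 3 - c₆ ^ 2)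
    (hΔ : Δ ≠ 0) (hc4 : c₄ ≠ 0) (hc6 : c₆ ≠ 0) :
    (3 * padicValRat 3 c₄ < 2 * padicValRat 3 c₆ ∧ padicValRat 3 Δ = 3 * padicValRat 3 c₄ - 3) ∨
    (2 * padicValRat 3 c₆ < 3 * padicValRat 3 c₄ ∧ padicValRat 3 Δ = 2 * padicValRat 3 c₆ - 3) ∨
    (3 * padicValRat 3 c₄ = 2 * padicValRat 3 c₆ ∧ 3 * padicValRat 3 c₄ - 3 ≤ padicValRat 3 Δ) := by
  have hsum0 : c₄ ^ 3 + -(c₆ ^ 2) ≠ 0 := by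
    rw [← sub_eq_add_neg, ← hrel]; exact mul_ne_zero (by norm_num) hΔ
  have hL : padicValRat 3 (c₄ ^ 3 + -(c₆ ^ 2)) = padicValRat 3 Δ + 3 := by
    rw [← sub_eq_add_neg, ← hrel, padicValRat.mul (by norm_num) hΔ, padicValRat_three_1728]; ring
  have h3 : padicValRat 3 (c₄ ^ 3) = 3 * padicValRat 3 c₄ := by rw [padicValRat.pow]; rfl
  have h2 : padicValRat 3 (-(c₆ ^ 2)) = 2 * padicValRat 3 c₆ := by
    rw [padicValRat.neg, padicValRat.pow]; rfl
  have hne1 : c₄ ^ 3 ≠ 0 := pow_ne_zero 3 hc4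
  have hne2 : -(c₆ ^ 2) ≠ 0 := neg_ne_zero.mpr (pow_ne_zero 2 hc6)
  rcases lt_trichotomy (3 * padicValRat 3 c₄) (2 * padicValRat 3 c₆) with h | h | h
  · refine Or.inl ⟨h, ?_⟩
    have hmin := padicValRat.add_eq_min hsum0 hne1 hne2 (by rw [h3, h2]; exact h.ne)
    rw [hL, h3, h2, min_eq_left h.le] at hmin
    omega
  · refine Or.inr (Or.inr ⟨h, ?_⟩)
    have hmin := padicValRat.min_le_padicValRat_add (p := 3) hsum0
    rw [hL, h3, h2, ← h, min_self] at hmin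
    omega
  · refine Or.inr (Or.inl ⟨h, ?_⟩)
    have hmin := padicValRat.add_eq_min hsum0 hne1 hne2 (by rw [h3, h2]; exact h.ne')
    rw [hL, h3, h2, min_eq_right h.le] at hmin
    omega

/-- `c₄ = 0`: then `c₆ ≠ 0` and `γ = 2β − 3` (`−c₆² = 1728Δ`). [folklore] -/
private theorem padicValRat_of_c_relation_of_c₄_eq_zero {c₄ c₆ Δ : ℚ} (hrel : 1728 * Δ = c₄ ^ 3 - c₆ ^ 2)
    (hΔ : Δ ≠ 0) (hc4 : c₄ = 0) : c₆ ≠ 0 ∧ padicValRat 3 Δ = 2 * padicValRat 3 c₆ - 3 := by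
  subst hc4
  have h0 : 1728 * Δ = -(c₆ ^ 2) := by rw [hrel]; ring
  have hc6 : c₆ ≠ 0 := by
    rintro rfl
    exact mul_ne_zero (by norm_num : (1728 : ℚ) ≠ 0) hΔ (by rw [h0]; ring)
  refine ⟨hc6, ?_⟩
  have hv := congrArg (padicValRat 3) h0
  rw [padicValRat.mul (by norm_num) hΔ, padicValRat_three_1728, padicValRat.neg, padicValRat.pow] at hv
  push_cast at hv
  omega

/-- `c₆ = 0`: then `c₄ ≠ 0` and `γ = 3α − 3` (`c₄³ = 1728Δ`). [folklore] -/
private theorem padicValRat_of_c_relation_of_c₆_eq_zero {c₄ c₆ Δ : ℚ} (hrel : 1728 * Δ = c₄ ^ 3 - c₆ ^ 2)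
    (hΔ : Δ ≠ 0) (hc6 : c₆ = 0) : c₄ ≠ 0 ∧ padicValRat 3 Δ = 3 * padicValRat 3 c₄ - 3 := by
  subst hc6
  have h0 : 1728 * Δ = c₄ ^ 3 := by rw [hrel]; ring
  have hc4 : c₄ ≠ 0 := by
    rintro rfl
    exact mul_ne_zero (by norm_num : (1728 : ℚ) ≠ 0) hΔ (by rw [h0]; ring)
  refine ⟨hc4, ?_⟩
  have hv := congrArg (padicValRat 3) h0
  rw [padicValRat.mul (by norm_num) hΔ, padicValRat_three_1728, padicValRat.pow] at hv
  push_cast at hv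
  omega

/-! ### Table II on the invariants of a Weierstrass equation over `ℚ` -/

/-- **Rizzo §1.2 on arbitrary invariants: `W₃ = ±1`.**  For rational `c₄, c₆, Δ` with
`1728·Δ = c₄³ − c₆²` and `Δ ≠ 0` — the invariants of ANY Weierstrass equation of an elliptic curve over
`ℚ ⊆ ℚ₃` — Table II read on the reduced triple and the residues (`Rizzo.ofInvariants`, §1.1–1.2) returns
`W₃ = +1` or `−1`: the shift `m = min ⌊γ/12⌋ ⌊β/6⌋ ⌊α/4⌋` makes the reduced triple non-negative with
`a ≤ 3 ∨ b ≤ 5 ∨ c ≤ 11` and preserves the valuation trichotomy.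
[cite: Rizzo2003, §1.2 Remark 4 (p. 6) with Table II (p. 4)] -/
theorem w3OfInvariants_eq_one_or_eq_neg_one {c₄ c₆ Δ : ℚ} (hrel : 1728 * Δ = c₄ ^ 3 - c₆ ^ 2)
    (hΔ : Δ ≠ 0) : w3OfInvariants c₄ c₆ Δ = 1 ∨ w3OfInvariants c₄ c₆ Δ = -1 := by
  unfold w3OfInvariants ofInvariants
  dsimp only
  set m := KellockDokchitser.shift (padicValRat 3 Δ) (val3 c₆) (val3 c₄) with hm
  by_cases hc4 : c₄ = 0
  · obtain ⟨hc6, hv⟩ := padicValRat_of_c_relation_of_c₄_eq_zero hrel hΔ hc4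
    have hv4 : val3 c₄ = ⊤ := by simp [val3, hc4]
    have hv6 : val3 c₆ = ((padicValRat 3 c₆ : ℤ) : WithTop ℤ) := by simp [val3, hc6]
    have hs : m = min (padicValRat 3 Δ / 12) (padicValRat 3 c₆ / 6) := by rw [hm, hv4, hv6]; rfl
    rw [hv4, hv6, WithTop.map_top, WithTop.map_coe]
    have hm1 : m ≤ padicValRat 3 Δ / 12 := hs ▸ min_le_left _ _
    have hm2 : m ≤ padicValRat 3 c₆ / 6 := hs ▸ min_le_right _ _
    have hm3 := min_choice (padicValRat 3 Δ / 12) (padicValRat 3 c₆ / 6)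
    rw [← hs] at hm3
    exact tableII_w_eq_one_or_eq_neg_one_of_c₄_eq_zero _ _ _ _ _ (by omega) (by omega) (by omega)
      (by omega)
  by_cases hc6 : c₆ = 0
  · obtain ⟨-, hv⟩ := padicValRat_of_c_relation_of_c₆_eq_zero hrel hΔ hc6
    have hv4 : val3 c₄ = ((padicValRat 3 c₄ : ℤ) : WithTop ℤ) := by simp [val3, hc4]
    have hv6 : val3 c₆ = ⊤ := by simp [val3, hc6]
    have hs : m = min (padicValRat 3 Δ / 12) (padicValRat 3 c₄ / 4) := by rw [hm, hv4, hv6]; rfl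
    rw [hv4, hv6, WithTop.map_top, WithTop.map_coe]
    have hm1 : m ≤ padicValRat 3 Δ / 12 := hs ▸ min_le_left _ _
    have hm2 : m ≤ padicValRat 3 c₄ / 4 := hs ▸ min_le_right _ _
    have hm3 := min_choice (padicValRat 3 Δ / 12) (padicValRat 3 c₄ / 4)
    rw [← hs] at hm3
    exact tableII_w_eq_one_or_eq_neg_one_of_c₆_eq_zero _ _ _ _ _ (by omega) (by omega) (by omega)
      (by omega)
  · have hv := padicValRat_trichotomy_of_c_relation hrel hΔ hc4 hc6
    have hv4 : val3 c₄ = ((padicValRat 3 c₄ : ℤ) : WithTop ℤ) := by simp [val3, hc4]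
    have hv6 : val3 c₆ = ((padicValRat 3 c₆ : ℤ) : WithTop ℤ) := by simp [val3, hc6]
    have hs : m = min (min (padicValRat 3 Δ / 12) (padicValRat 3 c₆ / 6)) (padicValRat 3 c₄ / 4) := by
      rw [hm, hv4, hv6]; rfl
    rw [hv4, hv6, WithTop.map_coe, WithTop.map_coe]
    have hm1 : m ≤ padicValRat 3 Δ / 12 := hs ▸ (min_le_left _ _).trans (min_le_left _ _)
    have hm2 : m ≤ padicValRat 3 c₆ / 6 := hs ▸ (min_le_left _ _).trans (min_le_right _ _)
    have hm3 : m ≤ padicValRat 3 c₄ / 4 := hs ▸ min_le_right _ _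
    have hm4 : m = padicValRat 3 Δ / 12 ∨ m = padicValRat 3 c₆ / 6 ∨ m = padicValRat 3 c₄ / 4 := by
      rcases min_choice (min (padicValRat 3 Δ / 12) (padicValRat 3 c₆ / 6)) (padicValRat 3 c₄ / 4)
        with h | h
      · rcases min_choice (padicValRat 3 Δ / 12) (padicValRat 3 c₆ / 6) with h' | h'
        · exact Or.inl (by rw [hs, h, h'])
        · exact Or.inr (Or.inl (by rw [hs, h, h']))
      · exact Or.inr (Or.inr (by rw [hs, h]))
    exact tableII_w_eq_one_or_eq_neg_one_of_trichotomy _ _ _ _ _ _ (by omega) (by omega) (by omega)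
      (by omega) (by omega)

/-- **The documented junk value of Table II is never taken on the invariants of an elliptic curve
over `ℚ`** (the junk triple `(I₀, 0, 0)` has `W₃ = 0`). [cite: Rizzo2003, §1.2 Remark 4 (p. 6)] -/
theorem ofInvariants_ne_junk {c₄ c₆ Δ : ℚ} (hrel : 1728 * Δ = c₄ ^ 3 - c₆ ^ 2) (hΔ : Δ ≠ 0) :
    ofInvariants c₄ c₆ Δ ≠ (.I 0, 0, 0) := by
  intro h
  have hw := w3OfInvariants_eq_one_or_eq_neg_one hrel hΔ
  rw [w3OfInvariants, h] at hw
  simp at hw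

end Rizzo

end Literature.NumberTheory.EllipticCurves

/-! ### Curves over `ℚ` -/

namespace WeierstrassCurve

open Literature.NumberTheory.EllipticCurves

variable (W : WeierstrassCurve ℚ)

/-- **Table II is complete on elliptic curves over `ℚ`: `W₃ = ±1`** (Rizzo 2003, §1.2 "Admissible
triplets", Remark 4: "If `p = 3`, we can read the list of admissible values in Table III of
[Papadopoulos 1993]: in particular, semi-admissibility still implies admissibility"; §1.3: the tables are
proved on "Papadopolous' list of possible triplets").  For every `W : WeierstrassCurve ℚ` with `Δ ≠ 0` —
ANY equation over `ℚ`, integral or not, minimal or not — the value `W.rootNumberThree` that Rizzo's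
Table II assigns to `w(E/ℚ₃)` is `+1` or `−1`; the junk value `0` (off the rows) is never taken.  This is
the hypothesis "Table II signs are signs" (`∀ W [W.IsElliptic], W.rootNumberThree = 1 ∨
W.rootNumberThree = -1`) of downstream files, fed by name.  Deliberate dot-notation extension of
Mathlib's `WeierstrassCurve` namespace, as `rootNumberThree` itself.
[cite: Rizzo2003, §1.2 Remark 4 (p. 6) with Table II (p. 4)] -/
theorem rootNumberThree_eq_one_or_eq_neg_one [W.IsElliptic] :
    W.rootNumberThree = 1 ∨ W.rootNumberThree = -1 :=
  Rizzo.w3OfInvariants_eq_one_or_eq_neg_one W.c_relation (by rw [← W.coe_Δ']; exact W.Δ'.ne_zero)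

/-- `W₃² = 1` for every elliptic `W / ℚ` (Table II is complete). [cite: Rizzo2003, §1.2 Remark 4 (p. 6)] -/
theorem rootNumberThree_sq_eq_one [W.IsElliptic] : W.rootNumberThree ^ 2 = 1 := by
  rcases W.rootNumberThree_eq_one_or_eq_neg_one with h | h <;> rw [h] <;> norm_num

/-- `W₃ ≠ 0` for every elliptic `W / ℚ`: the junk value of Table II is never taken.
[cite: Rizzo2003, §1.2 Remark 4 (p. 6)] -/
theorem rootNumberThree_ne_zero [W.IsElliptic] : W.rootNumberThree ≠ 0 := by
  rcases W.rootNumberThree_eq_one_or_eq_neg_one with h | h <;> rw [h] <;> norm_num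

end WeierstrassCurve
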